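import Summits.Langlands.Langlands.Theses.PhantomRMYoshida
import Summits.Langlands.Langlands.Theorems.PhantomRMYoshidaFaltingsFinitenessIOfIsogenyBound
import Summits.Langlands.Langlands.Theorems.PhantomRMYoshidaFaltingsFinitenessIKernelBoundConverse
import HarnessLib

/-!
# Crux `PhantomRMYoshida.FaltingsFinitenessI` (item stmt-Langlands-15084) — line `Sketch`, skeleton (rev 3)

Lead skeleton of the picked line (card `isogeny-degree-bound`; same engine as card
`bounded-isogeny-exponent-switch`): **Faltings' Finiteness I over `ℚ` from the minimal-isogeny
bound, by counting geometric kernels.** After wave 1 every stub but the transcendental kernel K1 is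
LANDED in `Summits/Langlands/Langlands/Theorems/`:

* `stub_ker_geomPointsMap_le_geomTorsion` — p98532, `…FaltingsFinitenessIKerGeomTorsion.lean`
  (the geometric kernel of an isogeny is killed by its degree; Deligne);
* `stub_exists_comp_eq_of_ker_geomPointsMap_le` — p99840, `…FaltingsFinitenessIGeomQuotient.lean`
  (in characteristic `0` an isogeny is the quotient by its geometric kernel; via the étale isogeny
  `[deg g]` and Milne 1986 Lemma 12.6, no Cartier);
* `stub_faltingsFinitenessI_of_isogenyKernelBound` — p102347, `…FaltingsFinitenessIOfIsogenyBound.lean`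
  (P1, the counting reduction; general form `exists_isoClasses_of_isogeny_kerRank_le` over any
  field of characteristic `0`);
* `stub_isogenyKernelBound_of_faltingsFinitenessI` — p101140,
  `…FaltingsFinitenessIKernelBoundConverse.lean` (P2, the converse: the transfer is an equivalence).

OPEN: `stub_isogenyKernelBound` (K1) = the Masser–Wüstholz isogeny theorem (Publ. Math. IHÉS 81
(1995), Theorem II, polarisation-free) at `k = ℚ` in qualitative form — vendored as the named fact
`exists_isogeny_kerRank_le_of_isIsogenous` [cite: MasserWustholz1995, Theorem II] (file
`…FaltingsFinitenessIOfMasserWustholz.lean`, conditional closer `faltingsFinitenessI_of_masserWustholz`).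
Only the `∃ g` form is true (Disproof.lean `not_isogenyKernelBoundForall` refutes the `∀ g` form).
Its proof (period theorem, stable Faltings height in dimension `≥ 2`, Zarhin's trick, quantitative
Jordan–Zassenhaus) is absent from Mathlib and the tree: crux-sized.

Composition: `FaltingsFinitenessI_of = stub_faltingsFinitenessI_of_isogenyKernelBound stub_isogenyKernelBound`.
-/

set_option linter.dupNamespace false -- `Summit.Langlands.Langlands` is the mandated namespace (summit = sub-problem)

noncomputable section

open CategoryTheory
open Literature.AlgebraicGeometry.Motives
open Literature.AlgebraicGeometry.Motives.AbelianVariety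
open Summit.Langlands.Langlands.Theorems.PhantomRMYoshida

namespace Summit.Langlands.Langlands.Cruxes.FaltingsFinitenessI.Sketch

/-- **K1 — the minimal-isogeny bound over `ℚ`** (Masser–Wüstholz, Publ. Math. IHÉS 81 (1995),
Theorem II, polarisation-free; polarised form Ann. of Math. 137 (1993) = Baker–Wüstholz 2007
Thm. 7.5; explicit: Gaudron–Rémond, Duke Math. J. 163 (2014), Thm. 1.4): for every abelian variety
`A / ℚ` there is `N` such that every `B / ℚ` isogenous to `A` is the target of an isogeny `A → B`
of degree (order of the kernel group scheme, `Hom.kerRank`) at most `N`. The crux-sized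
transcendental kernel of the line; = the named fact `exists_isogeny_kerRank_le_of_isIsogenous` at
`K = ℚ`. -/
theorem stub_isogenyKernelBound :
    ∀ A : AbelianVariety ℚ, ∃ N : ℕ, ∀ B : AbelianVariety ℚ, IsIsogenous B A →
      ∃ g : A ⟶ B, IsIsogeny g ∧ Hom.kerRank g ≤ N := by
  sorry

/-- **Finiteness I over `ℚ` from the stubs** (the line's composition): the landed counting
reduction P1 applied to K1. -/
theorem FaltingsFinitenessI_of : Summit.Langlands.Langlands.Theses.PhantomRMYoshida.FaltingsFinitenessI :=
  stub_faltingsFinitenessI_of_isogenyKernelBound stub_isogenyKernelBound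

/-- **The transfer is an equivalence** (both directions landed): the crux holds iff the
isogeny-kernel bound over `ℚ`. -/
theorem faltingsFinitenessI_iff_isogenyKernelBound :
    Summit.Langlands.Langlands.Theses.PhantomRMYoshida.FaltingsFinitenessI ↔
      ∀ A : AbelianVariety ℚ, ∃ N : ℕ, ∀ B : AbelianVariety ℚ, IsIsogenous B A →
        ∃ g : A ⟶ B, IsIsogeny g ∧ Hom.kerRank g ≤ N :=
  ⟨stub_isogenyKernelBound_of_faltingsFinitenessI, stub_faltingsFinitenessI_of_isogenyKernelBound⟩

end Summit.Langlands.Langlands.Cruxes.FaltingsFinitenessI.Sketch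

end
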